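import Literature.Topology.FourManifolds.SimplifiedBrokenLefschetzMorseCharts
import Literature.Topology.FourManifolds.SimplifiedBrokenLefschetzRoundImage
import Literature.Topology.FourManifolds.SphereHeightFoldCurves
import HarnessLib

/-!
# Critical points of a height function composed with an SBLF on the round locus

Topic `Literature/Topology/FourManifolds`; groundwork for the Euler count
`card_eq_four_mul_of_sblf_of_homotopyEquiv_sphere_four` (Baykur 2012, Lemma 7) of
`SimplifiedBrokenLefschetzFibration.lean`, in the Morse-theoretic reading by a global Morse
function `height a ∘ f` on the closed total space.  Everything here is **proved**; there are
no definitions and no named facts.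

Let `f : X → S²` be an SBLF whose round image is the equator `E = {y | y₂ = 0}`
(`IsSimplifiedBrokenLefschetzFibration.exists_image_round_eq_sphereEquator`) and
`ℓ = ⟪a, ·⟫` a height function with `a = (a₀, 0, a₂)`, `a₀ ≠ 0`, `a₂ ≠ 0`.  In a fold chart
`(φ, ψ)` at a round point `q` (Hayano 2011, Def. 2.1 (4); `φ q = 0`, hence `ψ (f q) = 0`) the
germ `Γ = ψ⁻¹ : ℝ² → S² ⊆ ℝ³` is `C^∞`, has injective differential and carries the axis
`{(t, 0)}` (the image of the fold locus) into `E`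
(`IsSimplifiedBrokenLefschetzFibration.sphereGerm_of_fold_chart`).  The calculus of such germs
(`SphereHeightFoldCurves.lean`) then gives, with the tree's fold-chart Morse data
(`isMCriticalPt_comp_iff_of_fold_chart`, `nondegenerate_and_morseIndex_comp_of_fold_chart`):

* `IsSimplifiedBrokenLefschetzFibration.isMCriticalPt_height_comp_iff_of_round` — **a round
  point `q` is critical for `ℓ ∘ f` iff `(f q)₁ = 0`**, i.e. `f q = (±1, 0, 0)`, the two points
  where `ℓ|_E` is critical;
* `IsSimplifiedBrokenLefschetzFibration.nondegenerate_and_odd_morseIndex_add_of_round` — at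
  such a point `ℓ ∘ f` is nondegenerate for both `a = (a₀, 0, a₂)` and `a' = (-a₀, 0, a₂)`, and
  **the two Morse indices have opposite parity**: the Hessian in the fold chart is
  `diag(∓a₀ (f q)₀ c², 2β, 2β, -2β)` with `β = a₂ ∂ₛΓ₂ ≠ 0` independent of the sign of `a₀`
  (Milnor 1963, §2) — so the round contributions to the Morse counts for `a` and `a'` cancel;
* `IsSimplifiedBrokenLefschetzFibration.finite_round_inter_apply_one_eq_zero` — there are
  finitely many such points (`f` is injective on the critical set and `E ∩ {y₁ = 0}` has two
  points).

## References

* R. İ. Baykur, *Broken Lefschetz fibrations and smooth structures on 4-manifolds*, Geom. Topol.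
  Monogr. 18 (2012), Lemma 7. [Baykur2012]
* K. Hayano, *On genus-1 simplified broken Lefschetz fibrations*, Algebr. Geom. Topol. 11 (2011),
  Def. 2.1. [Hayano2011]
* J. Milnor, *Morse theory* (1963), §2. [Milnor1963]
-/

noncomputable section

open scoped Manifold ContDiff Topology RealInnerProductSpace
open Set Function Filter Metric

namespace Literature.Topology.FourManifolds

universe u

namespace IsSimplifiedBrokenLefschetzFibration

variable {X : Type u} [TopologicalSpace X] [ChartedSpace (EuclideanSpace ℝ (Fin 4)) X]
  [IsManifold (𝓡 4) ∞ X] {o : SmoothOrientation (𝓡 4) X}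
  {f : X → (Metric.sphere (0 : EuclideanSpace ℝ (Fin 3)) 1)} {L : Finset X} {h : ℕ}

/-! ### The germ `ψ⁻¹` of a fold chart at a round point -/

section Germ

variable {φ : OpenPartialHomeomorph X (EuclideanSpace ℝ (Fin 4))}
  {ψ : OpenPartialHomeomorph (Metric.sphere (0 : EuclideanSpace ℝ (Fin 3)) 1)
    (EuclideanSpace ℝ (Fin 2))}

omit [ChartedSpace (EuclideanSpace ℝ (Fin 4)) X] [IsManifold (𝓡 4) ∞ X] in
/-- In a fold chart centred at `q` (`φ q = 0`), `ψ (f q) = 0`. [cite: Hayano2011, Def. 2.1 (4)] -/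
theorem base_apply_eq_zero_of_fold_chart
    (hmodel : ∀ q ∈ φ.source, (ψ (f q)) 0 = (φ q) 0 ∧
      (ψ (f q)) 1 = (φ q) 1 ^ 2 + (φ q) 2 ^ 2 - (φ q) 3 ^ 2)
    {q : X} (hq : q ∈ φ.source) (hq0 : φ q = 0) : ψ (f q) = 0 := by
  rw [apply_eq_foldNormalForm_of_fold_chart hmodel hq, hq0]
  ext i
  fin_cases i <;> simp

/-- **The germ `Γ = ψ⁻¹ : ℝ² → S² ⊆ ℝ³` of a fold chart of an SBLF with equatorial round image**:
`Γ` is `C²` at `0`, unit length, carries the axis `{(t, 0)}` near `0` into the equator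
`{y₂ = 0}` (points of the axis of the fold chart are round points, whose values lie on the round
image), has injective differential at `0`, and `Γ 0 = f q`. [cite: Hayano2011, Def. 2.1 (4)] -/
theorem sphereGerm_of_fold_chart (hf : IsSimplifiedBrokenLefschetzFibration o f L h)
    (hround : f '' ({p : X | ¬ Surjective (mfderiv (𝓡 4) (𝓡 2) f p)} \ (↑L : Set X)) =
      sphereEquator 1)
    {q : X} (hq : q ∈ φ.source) (hq0 : φ q = 0) (hmaps : Set.MapsTo f φ.source ψ.source)
    (hφ : ContMDiffOn (𝓡 4) (𝓡 4) ∞ φ φ.source) (hφs : ContMDiffOn (𝓡 4) (𝓡 4) ∞ φ.symm φ.target)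
    (hψ : ContMDiffOn (𝓡 2) (𝓡 2) ∞ ψ ψ.source) (hψs : ContMDiffOn (𝓡 2) (𝓡 2) ∞ ψ.symm ψ.target)
    (hmodel : ∀ q ∈ φ.source, (ψ (f q)) 0 = (φ q) 0 ∧
      (ψ (f q)) 1 = (φ q) 1 ^ 2 + (φ q) 2 ^ 2 - (φ q) 3 ^ 2) :
    ContDiffAt ℝ 2 (fun w => ((ψ.symm w : Metric.sphere (0 : EuclideanSpace ℝ (Fin 3)) 1) :
      EuclideanSpace ℝ (Fin 3))) 0 ∧
    (∀ᶠ w in 𝓝 (0 : EuclideanSpace ℝ (Fin 2)),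
      ‖((ψ.symm w : Metric.sphere (0 : EuclideanSpace ℝ (Fin 3)) 1) : EuclideanSpace ℝ (Fin 3))‖ = 1) ∧
    (∀ᶠ t in 𝓝 (0 : ℝ), ((ψ.symm (t • EuclideanSpace.single (0 : Fin 2) (1 : ℝ)) :
      Metric.sphere (0 : EuclideanSpace ℝ (Fin 3)) 1) : EuclideanSpace ℝ (Fin 3)) 2 = 0) ∧
    Injective (fderiv ℝ (fun w => ((ψ.symm w : Metric.sphere (0 : EuclideanSpace ℝ (Fin 3)) 1) :
      EuclideanSpace ℝ (Fin 3))) 0) ∧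
    ((ψ.symm 0 : Metric.sphere (0 : EuclideanSpace ℝ (Fin 3)) 1) : EuclideanSpace ℝ (Fin 3)) =
      (f q : EuclideanSpace ℝ (Fin 3)) := by
  haveI : Fact (Module.finrank ℝ (EuclideanSpace ℝ (Fin 3)) = 2 + 1) :=
    ⟨finrank_euclideanSpace_fin⟩
  set Γ : EuclideanSpace ℝ (Fin 2) → EuclideanSpace ℝ (Fin 3) :=
    fun w => ((ψ.symm w : Metric.sphere (0 : EuclideanSpace ℝ (Fin 3)) 1) :
      EuclideanSpace ℝ (Fin 3)) with hΓ
  have hψ0 : ψ (f q) = 0 := base_apply_eq_zero_of_fold_chart hmodel hq hq0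
  have hfq : f q ∈ ψ.source := hmaps hq
  have h0t : (0 : EuclideanSpace ℝ (Fin 2)) ∈ ψ.target := hψ0 ▸ ψ.map_source hfq
  have hsymm0 : ψ.symm 0 = f q := by rw [← hψ0, ψ.left_inv hfq]
  -- smoothness
  have hval : ContMDiff (𝓡 2) 𝓘(ℝ, EuclideanSpace ℝ (Fin 3)) ∞
      (Subtype.val : Metric.sphere (0 : EuclideanSpace ℝ (Fin 3)) 1 → EuclideanSpace ℝ (Fin 3)) :=
    contMDiff_coe_sphere
  have hψs0 : ContMDiffAt (𝓡 2) (𝓡 2) ∞ ψ.symm 0 :=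
    (hψs 0 h0t).contMDiffAt (ψ.open_target.mem_nhds h0t)
  have hΓs : ContMDiffAt 𝓘(ℝ, EuclideanSpace ℝ (Fin 2)) 𝓘(ℝ, EuclideanSpace ℝ (Fin 3)) ∞ Γ 0 :=
    (hval _).comp 0 hψs0
  have hΓ2 : ContDiffAt ℝ 2 Γ 0 := (contMDiffAt_iff_contDiffAt.1 hΓs).of_le (by norm_cast)
  -- unit length
  have hS : ∀ᶠ w in 𝓝 (0 : EuclideanSpace ℝ (Fin 2)), ‖Γ w‖ = 1 :=
    Eventually.of_forall fun w => by simp [hΓ, norm_eq_of_mem_sphere]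
  -- the axis goes to the equator
  have hE : ∀ᶠ t in 𝓝 (0 : ℝ), Γ (t • EuclideanSpace.single (0 : Fin 2) (1 : ℝ)) 2 = 0 := by
    have hc : Continuous fun t : ℝ => t • EuclideanSpace.single (0 : Fin 4) (1 : ℝ) :=
      continuous_id.smul continuous_const
    have h0φ : (0 : EuclideanSpace ℝ (Fin 4)) ∈ φ.target := hq0 ▸ φ.map_source hq
    have hev : ∀ᶠ t : ℝ in 𝓝 0, t • EuclideanSpace.single (0 : Fin 4) (1 : ℝ) ∈ φ.target := by
      have := hc.continuousAt (x := 0)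
      rw [ContinuousAt, zero_smul] at this
      exact this (φ.open_target.mem_nhds h0φ)
    filter_upwards [hev] with t ht
    set v : EuclideanSpace ℝ (Fin 4) := t • EuclideanSpace.single (0 : Fin 4) (1 : ℝ) with hv
    set qt : X := φ.symm v with hqt
    have hqts : qt ∈ φ.source := φ.map_target ht
    have hφqt : φ qt = v := φ.right_inv ht
    have haxis : (φ qt) 1 = 0 ∧ (φ qt) 2 = 0 ∧ (φ qt) 3 = 0 := by
      rw [hφqt, hv]; simp
    have hfd : MDifferentiableAt (𝓡 4) (𝓡 2) f qt := (hf.contMDiff qt).mdifferentiableAt (by simp)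
    have hns : ¬ Surjective (mfderiv (𝓡 4) (𝓡 2) f qt) := by
      rw [surjective_mfderiv_iff_of_fold_chart hmaps (hφ.of_le (by norm_cast))
        (hφs.of_le (by norm_cast)) (hψ.of_le (by norm_cast)) (hψs.of_le (by norm_cast)) hmodel
        hqts hfd]
      exact fun h' => h' haxis
    have hqtL : qt ∉ L := by
      intro hL
      obtain ⟨c, -⟩ := hf.lefschetz qt hL
      exact mfderiv_ne_zero_of_fold_chart hmaps (hφ.of_le (by norm_cast))
        (hφs.of_le (by norm_cast)) (hψ.of_le (by norm_cast)) (hψs.of_le (by norm_cast)) hmodel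
        hqts hfd c.mfderiv_eq_zero
    have hround' : f qt ∈ sphereEquator 1 := by
      rw [← hround]
      exact ⟨qt, ⟨hns, by simpa using hqtL⟩, rfl⟩
    have h2 : ((f qt : Metric.sphere (0 : EuclideanSpace ℝ (Fin 3)) 1) : EuclideanSpace ℝ (Fin 3)) 2 = 0 :=
      (mem_sphereEquator_iff (f qt)).1 hround'
    -- `ψ (f qt) = (t, 0)`
    have hψqt : ψ (f qt) = t • EuclideanSpace.single (0 : Fin 2) (1 : ℝ) := by
      rw [apply_eq_foldNormalForm_of_fold_chart hmodel hqts, hφqt, hv]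
      ext i
      fin_cases i <;> simp
    have : ψ.symm (t • EuclideanSpace.single (0 : Fin 2) (1 : ℝ)) = f qt := by
      rw [← hψqt, ψ.left_inv (hmaps hqts)]
    simp only [hΓ, this, h2]
  -- injectivity of `DΓ(0)`
  have hinj : Injective (fderiv ℝ Γ 0) := by
    have hψsd : MDifferentiableAt (𝓡 2) (𝓡 2) ψ.symm 0 := hψs0.mdifferentiableAt (by simp)
    have hψd : MDifferentiableAt (𝓡 2) (𝓡 2) ψ (ψ.symm 0) := by
      rw [hsymm0]
      exact ((hψ _ hfq).contMDiffAt (ψ.open_source.mem_nhds hfq)).mdifferentiableAt (by simp)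
    -- `dψ ∘ d(ψ⁻¹) = id` at `0`
    have hid : (mfderiv (𝓡 2) (𝓡 2) ψ (ψ.symm 0)).comp (mfderiv (𝓡 2) (𝓡 2) ψ.symm 0) =
        ContinuousLinearMap.id ℝ _ := by
      rw [← mfderiv_comp 0 hψd hψsd]
      have hev : (ψ ∘ ψ.symm) =ᶠ[𝓝 (0 : EuclideanSpace ℝ (Fin 2))] id :=
        (ψ.eventually_right_inverse h0t).mono fun y hy => by simpa using hy
      rw [hev.mfderiv_eq, mfderiv_id]
    have hinj₁ : Injective (mfderiv (𝓡 2) (𝓡 2) ψ.symm 0) := by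
      refine Function.LeftInverse.injective (g := mfderiv (𝓡 2) (𝓡 2) ψ (ψ.symm 0)) fun v => ?_
      have := DFunLike.congr_fun hid v
      exact this
    have hinj₂ : Injective (mfderiv (𝓡 2) 𝓘(ℝ, EuclideanSpace ℝ (Fin 3))
        (Subtype.val : Metric.sphere (0 : EuclideanSpace ℝ (Fin 3)) 1 → EuclideanSpace ℝ (Fin 3))
        (ψ.symm 0)) := mfderiv_coe_sphere_injective (ψ.symm 0)
    have hvald : MDifferentiableAt (𝓡 2) 𝓘(ℝ, EuclideanSpace ℝ (Fin 3))
        (Subtype.val : Metric.sphere (0 : EuclideanSpace ℝ (Fin 3)) 1 → EuclideanSpace ℝ (Fin 3))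
        (ψ.symm 0) := (hval _).mdifferentiableAt (by simp)
    have hcomp : fderiv ℝ Γ 0 = (mfderiv (𝓡 2) 𝓘(ℝ, EuclideanSpace ℝ (Fin 3))
        (Subtype.val : Metric.sphere (0 : EuclideanSpace ℝ (Fin 3)) 1 → EuclideanSpace ℝ (Fin 3))
        (ψ.symm 0)).comp (mfderiv (𝓡 2) (𝓡 2) ψ.symm 0) := by
      rw [← mfderiv_eq_fderiv, hΓ]
      exact mfderiv_comp 0 hvald hψsd
    rw [hcomp]
    exact hinj₂.comp hinj₁
  exact ⟨hΓ2, hS, hE, hinj, by rw [hsymm0]⟩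

end Germ

/-! ### Height functions read through the germ -/

section Height

open SphereHeight

/-- `(height b ∘ ψ⁻¹) = ⟪b, Γ ·⟫` with `Γ = ψ⁻¹` viewed in `ℝ³`. [folklore] -/
theorem height_comp_symm_eq (ψ : OpenPartialHomeomorph (Metric.sphere (0 : EuclideanSpace ℝ (Fin 3)) 1)
      (EuclideanSpace ℝ (Fin 2))) (b : EuclideanSpace ℝ (Fin 3)) :
    height b ∘ ψ.symm = (innerSL ℝ b : EuclideanSpace ℝ (Fin 3) →L[ℝ] ℝ) ∘
      (fun w => ((ψ.symm w : Metric.sphere (0 : EuclideanSpace ℝ (Fin 3)) 1) :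
        EuclideanSpace ℝ (Fin 3))) := by
  funext w
  simp [height_apply]

/-- First derivative of `⟪b, Γ⟫`: `D⟪b, Γ⟫(0) v = ⟪b, DΓ(0) v⟫`. [folklore] -/
theorem fderiv_inner_comp_apply {Γ : EuclideanSpace ℝ (Fin 2) → EuclideanSpace ℝ (Fin 3)}
    (b : EuclideanSpace ℝ (Fin 3)) {x : EuclideanSpace ℝ (Fin 2)} (hΓ : DifferentiableAt ℝ Γ x)
    (v : EuclideanSpace ℝ (Fin 2)) :
    fderiv ℝ ((innerSL ℝ b : EuclideanSpace ℝ (Fin 3) →L[ℝ] ℝ) ∘ Γ) x v = ⟪b, fderiv ℝ Γ x v⟫ := by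
  rw [((innerSL ℝ b : EuclideanSpace ℝ (Fin 3) →L[ℝ] ℝ).hasFDerivAt.comp x hΓ.hasFDerivAt).fderiv]
  simp

/-- Second derivative of `⟪b, Γ⟫`: `D²⟪b, Γ⟫(0) (v, w) = ⟪b, D²Γ(0) (v, w)⟫`. [folklore] -/
theorem fderiv_fderiv_inner_comp_apply {Γ : EuclideanSpace ℝ (Fin 2) → EuclideanSpace ℝ (Fin 3)}
    (b : EuclideanSpace ℝ (Fin 3)) {x : EuclideanSpace ℝ (Fin 2)} (hΓ : ContDiffAt ℝ 2 Γ x)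
    (v w : EuclideanSpace ℝ (Fin 2)) :
    fderiv ℝ (fderiv ℝ ((innerSL ℝ b : EuclideanSpace ℝ (Fin 3) →L[ℝ] ℝ) ∘ Γ)) x v w =
      ⟪b, fderiv ℝ (fderiv ℝ Γ) x v w⟫ := by
  set F : EuclideanSpace ℝ (Fin 3) →L[ℝ] ℝ := innerSL ℝ b with hF
  rw [fderiv_fderiv_comp_apply (F.contDiff.contDiffAt) hΓ v w, F.fderiv]
  have h0 : fderiv ℝ (fderiv ℝ (F : EuclideanSpace ℝ (Fin 3) → ℝ)) (Γ x) = 0 := by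
    rw [show fderiv ℝ (F : EuclideanSpace ℝ (Fin 3) → ℝ) = fun _ => F from funext fun u => F.fderiv]
    exact fderiv_const_apply _
  rw [h0]
  simp [hF]

/-- `⟪b, x⟫ = b₀ x₀ + b₂ x₂` when `b₁ = 0`. [folklore] -/
theorem inner_eq_of_apply_one_eq_zero {b : EuclideanSpace ℝ (Fin 3)} (hb : b 1 = 0)
    (x : EuclideanSpace ℝ (Fin 3)) : ⟪b, x⟫ = b 0 * x 0 + b 2 * x 2 := by
  rw [BandFoliation.inner_eq_three, hb, zero_mul, add_zero]

end Height

/-! ### Critical round points of `height a ∘ f` -/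

section Round

open SphereHeight

/-- **A round point `q` is critical for `⟪a, ·⟫ ∘ f` iff `(f q)₁ = 0`** (for an SBLF with
equatorial round image and `a = (a₀, 0, a₂)`, `a₀ ≠ 0`): in a fold chart only the derivative
of the height ALONG the round image `E = {y₂ = 0}` matters (`isMCriticalPt_comp_iff_of_fold_chart`),
and `⟪a, ·⟫|_E = a₀ y₀` is critical exactly at `y = (±1, 0, 0)`. [cite: Milnor1963, §2]
[cite: Baykur2012, Lemma 7] -/
theorem isMCriticalPt_height_comp_iff_of_round (hf : IsSimplifiedBrokenLefschetzFibration o f L h)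
    (hround : f '' ({p : X | ¬ Surjective (mfderiv (𝓡 4) (𝓡 2) f p)} \ (↑L : Set X)) =
      sphereEquator 1)
    {q : X} (hqs : ¬ Surjective (mfderiv (𝓡 4) (𝓡 2) f q)) (hqL : q ∉ L)
    {a : EuclideanSpace ℝ (Fin 3)} (ha1 : a 1 = 0) (ha0 : a 0 ≠ 0) :
    IsMCriticalPt (𝓡 4) (height a ∘ f) q ↔
      ((f q : Metric.sphere (0 : EuclideanSpace ℝ (Fin 3)) 1) : EuclideanSpace ℝ (Fin 3)) 1 = 0 := by
  obtain ⟨φ, ψ, hq, hq0, hmaps, hφ, hφs, hψ, hψs, hmodel⟩ := hf.fold q hqs hqL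
  obtain ⟨hΓ, hS, hE, hinj, hΓ0⟩ :=
    hf.sphereGerm_of_fold_chart hround hq hq0 hmaps hφ hφs hψ hψs hmodel
  have haxis : (φ q) 1 = 0 ∧ (φ q) 2 = 0 ∧ (φ q) 3 = 0 := by rw [hq0]; simp
  rw [isMCriticalPt_comp_iff_of_fold_chart hmaps hφ hφs hψs hmodel hf.contMDiff
    (contMDiff_height a) hq haxis, base_apply_eq_zero_of_fold_chart hmodel hq hq0,
    height_comp_symm_eq, fderiv_inner_comp_apply a (hΓ.differentiableAt (by simp)),
    inner_eq_of_apply_one_eq_zero ha1, SphereGerm.fderiv_single_zero_two hΓ hE, mul_zero,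
    add_zero, mul_eq_zero, SphereGerm.fderiv_single_zero_zero_eq_zero_iff hΓ hS hE hinj, ← hΓ0]
  simp [ha0]

/-- **Nondegeneracy and parity of the index at a critical round point** (Milnor 1963, §2 in a
fold chart, Hayano 2011, Def. 2.1 (4)).  Let `q` be a round point with `(f q)₁ = 0` of an SBLF
with equatorial round image, `a = (a₀, 0, a₂)` and `a' = (-a₀, 0, a₂)` with `a₀ ≠ 0`,
`a₂ ≠ 0`.  Then `q` is a nondegenerate critical point of both `⟪a, ·⟫ ∘ f` and `⟪a', ·⟫ ∘ f`,
and the two Morse indices have opposite parity: in the fold chart the Hessians are the diagonal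
forms `(α, 2β, 2β, -2β)` and `(-α, 2β, 2β, -2β)` with `α = -a₀ (f q)₀ (∂ₜΓ₁)² ≠ 0` and
`β = a₂ ∂ₛΓ₂ ≠ 0`. [cite: Milnor1963, §2] [cite: Baykur2012, Lemma 7] -/
theorem nondegenerate_and_odd_morseIndex_add_of_round
    (hf : IsSimplifiedBrokenLefschetzFibration o f L h)
    (hround : f '' ({p : X | ¬ Surjective (mfderiv (𝓡 4) (𝓡 2) f p)} \ (↑L : Set X)) =
      sphereEquator 1)
    {q : X} (hqs : ¬ Surjective (mfderiv (𝓡 4) (𝓡 2) f q)) (hqL : q ∉ L)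
    (hq1 : ((f q : Metric.sphere (0 : EuclideanSpace ℝ (Fin 3)) 1) : EuclideanSpace ℝ (Fin 3)) 1 = 0)
    {a a' : EuclideanSpace ℝ (Fin 3)} (ha1 : a 1 = 0) (ha'1 : a' 1 = 0) (ha0 : a 0 ≠ 0)
    (ha'0 : a' 0 = -a 0) (ha2 : a 2 ≠ 0) (ha'2 : a' 2 = a 2) :
    (mhessian (𝓡 4) (height a ∘ f) q).Nondegenerate ∧
    (mhessian (𝓡 4) (height a' ∘ f) q).Nondegenerate ∧
    Odd (morseIndex (𝓡 4) (height a ∘ f) q + morseIndex (𝓡 4) (height a' ∘ f) q) := by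
  have ha'0' : a' 0 ≠ 0 := by rw [ha'0]; exact neg_ne_zero.2 ha0
  obtain ⟨φ, ψ, hq, hq0, hmaps, hφ, hφs, hψ, hψs, hmodel⟩ := hf.fold q hqs hqL
  obtain ⟨hΓ, hS, hE, hinj, hΓ0⟩ :=
    hf.sphereGerm_of_fold_chart hround hq hq0 hmaps hφ hφs hψ hψs hmodel
  set Γ : EuclideanSpace ℝ (Fin 2) → EuclideanSpace ℝ (Fin 3) :=
    fun w => ((ψ.symm w : Metric.sphere (0 : EuclideanSpace ℝ (Fin 3)) 1) :
      EuclideanSpace ℝ (Fin 3)) with hΓdef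
  have haxis : (φ q) 1 = 0 ∧ (φ q) 2 = 0 ∧ (φ q) 3 = 0 := by rw [hq0]; simp
  have hψ0 : ψ (f q) = 0 := base_apply_eq_zero_of_fold_chart hmodel hq hq0
  have hΓ01 : Γ 0 1 = 0 := by
    show ((ψ.symm 0 : Metric.sphere (0 : EuclideanSpace ℝ (Fin 3)) 1) : EuclideanSpace ℝ (Fin 3)) 1 = 0
    rw [hΓ0]; exact hq1
  have h0 : fderiv ℝ Γ 0 (EuclideanSpace.single (0 : Fin 2) (1 : ℝ)) 0 = 0 :=
    (SphereGerm.fderiv_single_zero_zero_eq_zero_iff hΓ hS hE hinj).2 hΓ01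
  obtain ⟨hpm, hc, hsec, htan0, htan2⟩ :=
    SphereGerm.morseData_of_fderiv_single_zero_zero_eq_zero hΓ hS hE hinj h0
  have hsec2 := SphereGerm.fderiv_fderiv_single_zero_two hΓ hE
  -- first and second derivatives of `⟪b, Γ⟫` for `b = a, a'`
  have hβ : ∀ b : EuclideanSpace ℝ (Fin 3), b 1 = 0 →
      fderiv ℝ (height b ∘ ψ.symm) (ψ (f q)) (EuclideanSpace.single (1 : Fin 2) (1 : ℝ)) =
        b 2 * fderiv ℝ Γ 0 (EuclideanSpace.single (1 : Fin 2) (1 : ℝ)) 2 := by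
    intro b hb
    rw [hψ0, height_comp_symm_eq, fderiv_inner_comp_apply b (hΓ.differentiableAt (by simp)),
      inner_eq_of_apply_one_eq_zero hb, htan0, mul_zero, zero_add]
  have hα : ∀ b : EuclideanSpace ℝ (Fin 3), b 1 = 0 →
      fderiv ℝ (fderiv ℝ (height b ∘ ψ.symm)) (ψ (f q)) (EuclideanSpace.single (0 : Fin 2) (1 : ℝ))
          (EuclideanSpace.single (0 : Fin 2) (1 : ℝ)) =
        b 0 * (-(Γ 0 0) * (fderiv ℝ Γ 0 (EuclideanSpace.single (0 : Fin 2) (1 : ℝ)) 1) ^ 2) := by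
    intro b hb
    rw [hψ0, height_comp_symm_eq, fderiv_fderiv_inner_comp_apply b hΓ,
      inner_eq_of_apply_one_eq_zero hb, hsec, hsec2, mul_zero, add_zero]
  -- the quantities `α = a₀ A`, `β = a₂ B`
  set A : ℝ := -(Γ 0 0) * (fderiv ℝ Γ 0 (EuclideanSpace.single (0 : Fin 2) (1 : ℝ)) 1) ^ 2 with hAdef
  set B : ℝ := fderiv ℝ Γ 0 (EuclideanSpace.single (1 : Fin 2) (1 : ℝ)) 2 with hBdef
  have hΓ00 : (Γ 0 0) ^ 2 = 1 := by rcases hpm with h1 | h1 <;> rw [h1] <;> norm_num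
  have hA : A ≠ 0 := by
    have : Γ 0 0 ≠ 0 := by intro h0'; rw [h0'] at hΓ00; norm_num at hΓ00
    exact mul_ne_zero (neg_ne_zero.2 this) (pow_ne_zero 2 hc)
  have hαa : fderiv ℝ (fderiv ℝ (height a ∘ ψ.symm)) (ψ (f q))
      (EuclideanSpace.single (0 : Fin 2) (1 : ℝ)) (EuclideanSpace.single (0 : Fin 2) (1 : ℝ)) ≠ 0 := by
    rw [hα a ha1]; exact mul_ne_zero ha0 hA
  have hαa' : fderiv ℝ (fderiv ℝ (height a' ∘ ψ.symm)) (ψ (f q))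
      (EuclideanSpace.single (0 : Fin 2) (1 : ℝ)) (EuclideanSpace.single (0 : Fin 2) (1 : ℝ)) ≠ 0 := by
    rw [hα a' ha'1]; exact mul_ne_zero ha'0' hA
  have hβa : fderiv ℝ (height a ∘ ψ.symm) (ψ (f q)) (EuclideanSpace.single (1 : Fin 2) (1 : ℝ)) ≠ 0 := by
    rw [hβ a ha1]; exact mul_ne_zero ha2 htan2
  have hβa' : fderiv ℝ (height a' ∘ ψ.symm) (ψ (f q)) (EuclideanSpace.single (1 : Fin 2) (1 : ℝ)) ≠ 0 := by
    rw [hβ a' ha'1, ha'2]; exact mul_ne_zero ha2 htan2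
  -- criticality
  have hcrit : IsMCriticalPt (𝓡 4) (height a ∘ f) q :=
    (hf.isMCriticalPt_height_comp_iff_of_round hround hqs hqL ha1 ha0).2 hq1
  have hcrit' : IsMCriticalPt (𝓡 4) (height a' ∘ f) q :=
    (hf.isMCriticalPt_height_comp_iff_of_round hround hqs hqL ha'1 ha'0').2 hq1
  obtain ⟨hnd, hind⟩ := nondegenerate_and_morseIndex_comp_of_fold_chart hmaps hφ hφs hψs hmodel
    hf.contMDiff (contMDiff_height a) hq haxis hcrit hαa hβa
  obtain ⟨hnd', hind'⟩ := nondegenerate_and_morseIndex_comp_of_fold_chart hmaps hφ hφs hψs hmodel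
    hf.contMDiff (contMDiff_height a') hq haxis hcrit' hαa' hβa'
  refine ⟨hnd, hnd', ?_⟩
  rw [hind, hind', hα a ha1, hα a' ha'1, hβ a ha1, hβ a' ha'1, ha'0, ha'2, neg_mul]
  -- `[x < 0] + [-x < 0] = 1` for `x = a₀ A ≠ 0`, and the `β`-terms agree
  have hx0 : a 0 * A ≠ 0 := mul_ne_zero ha0 hA
  generalize ht : (if 0 < a 2 * B then 1 else 2 : ℕ) = t
  rcases lt_or_gt_of_ne hx0 with hlt | hgt
  · have h1 : ¬ (-(a 0 * A) < 0) := not_lt.2 (neg_nonneg.2 hlt.le)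
    simp only [hlt, h1, if_true, if_false]
    exact ⟨t, by ring⟩
  · have h1 : ¬ (a 0 * A < 0) := not_lt.2 hgt.le
    have h2 : -(a 0 * A) < 0 := neg_neg_iff_pos.2 hgt
    simp only [h1, h2, if_true, if_false]
    exact ⟨t, by ring⟩

/-- **There are finitely many round points `q` with `(f q)₁ = 0`** (an SBLF is injective on its
critical set, and the equator meets `{y₁ = 0}` in the two points `(±1, 0, 0)`).
[cite: Baykur2012, Lemma 7] -/
theorem finite_round_inter_apply_one_eq_zero (hf : IsSimplifiedBrokenLefschetzFibration o f L h)
    (hround : f '' ({p : X | ¬ Surjective (mfderiv (𝓡 4) (𝓡 2) f p)} \ (↑L : Set X)) =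
      sphereEquator 1) :
    {q : X | ¬ Surjective (mfderiv (𝓡 4) (𝓡 2) f q) ∧ q ∉ L ∧
      ((f q : Metric.sphere (0 : EuclideanSpace ℝ (Fin 3)) 1) : EuclideanSpace ℝ (Fin 3)) 1 = 0}.Finite := by
  set R : Set X := {q : X | ¬ Surjective (mfderiv (𝓡 4) (𝓡 2) f q) ∧ q ∉ L ∧
      ((f q : Metric.sphere (0 : EuclideanSpace ℝ (Fin 3)) 1) : EuclideanSpace ℝ (Fin 3)) 1 = 0}
    with hR
  -- `f`, hence `val ∘ f`, is injective on `R`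
  have hinj : InjOn (fun q => ((f q : Metric.sphere (0 : EuclideanSpace ℝ (Fin 3)) 1) :
      EuclideanSpace ℝ (Fin 3))) R := fun q hq q' hq' hqq =>
    hf.injOn_crit hq.1 hq'.1 (Subtype.ext hqq)
  -- the image lies in the two-point set `{(1, 0, 0), (-1, 0, 0)}`
  refine Set.Finite.of_finite_image ((Set.toFinite
    ({EuclideanSpace.single (0 : Fin 3) (1 : ℝ), EuclideanSpace.single (0 : Fin 3) (-1 : ℝ)} :
      Set (EuclideanSpace ℝ (Fin 3)))).subset ?_) hinj
  rintro _ ⟨q, ⟨hqs, hqL, hq1⟩, rfl⟩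
  have h2 : ((f q : Metric.sphere (0 : EuclideanSpace ℝ (Fin 3)) 1) : EuclideanSpace ℝ (Fin 3)) 2 = 0 := by
    have : f q ∈ sphereEquator 1 := by
      rw [← hround]; exact ⟨q, ⟨hqs, by simpa using hqL⟩, rfl⟩
    exact (mem_sphereEquator_iff (f q)).1 this
  have hn : ‖((f q : Metric.sphere (0 : EuclideanSpace ℝ (Fin 3)) 1) : EuclideanSpace ℝ (Fin 3))‖ = 1 :=
    norm_eq_of_mem_sphere (f q)
  have hx0 : ((f q : Metric.sphere (0 : EuclideanSpace ℝ (Fin 3)) 1) : EuclideanSpace ℝ (Fin 3)) 0 = 1 ∨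
      ((f q : Metric.sphere (0 : EuclideanSpace ℝ (Fin 3)) 1) : EuclideanSpace ℝ (Fin 3)) 0 = -1 := by
    have h' : ‖((f q : Metric.sphere (0 : EuclideanSpace ℝ (Fin 3)) 1) : EuclideanSpace ℝ (Fin 3))‖ ^ 2 =
        ((f q : Metric.sphere (0 : EuclideanSpace ℝ (Fin 3)) 1) : EuclideanSpace ℝ (Fin 3)) 0 *
          ((f q : Metric.sphere (0 : EuclideanSpace ℝ (Fin 3)) 1) : EuclideanSpace ℝ (Fin 3)) 0 := by
      rw [← real_inner_self_eq_norm_sq, BandFoliation.inner_eq_three, hq1, h2]; ring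
    rw [hn, one_pow] at h'
    exact mul_self_eq_one_iff.1 h'.symm
  simp only [mem_insert_iff, mem_singleton_iff]
  rcases hx0 with h0 | h0
  · left
    ext i
    fin_cases i
    · simpa using h0
    · simpa using hq1
    · simpa using h2
  · right
    ext i
    fin_cases i
    · simpa using h0
    · simpa using hq1
    · simpa using h2

end Round

end IsSimplifiedBrokenLefschetzFibration

end Literature.Topology.FourManifolds
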